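import Summits.RiemannHypothesis.RiemannHypothesis.Theorems.PfPersistenceGalerkinClosedFormIdentity
import Summits.RiemannHypothesis.RiemannHypothesis.Theorems.PfPersistenceGalerkinFormMellin
import Summits.RiemannHypothesis.RiemannHypothesis.Theorems.PfPersistenceGalerkinFloorTransfer
import Summits.RiemannHypothesis.RiemannHypothesis.Theorems.OddSectorOddOneSignedWindowsOddFormDomainPos
import HarnessLib

/-!
# The even-sector form-domain bound; GAL‑0 as typed (`GalerkinRayleighRitz`), unconditionally

`mechanism/rigidity campaign; no RH claims` (pub-rhpf, cand-3).  Everything here is RH-free.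
`PfPersistenceGalerkinFormDomain` typed GAL‑0 as `GalerkinRayleighRitz : ∀ win v, ε_ev(a)·(v ⬝ᵥ v) ≤
v ⬝ᵥ (zetaDatum win *ᵥ v)` and proved it from (i) `GalerkinMatrixIdentity` + (ii)
`CutoffProfileFormDensity`; `PfPersistenceGalerkinClosedFormIdentity` proved the closed form
`v ⬝ᵥ (zetaDatum win *ᵥ v) = P(f) + 𝓔_a(f) − M_a‖f‖²`, `f = cutoffProfile win v`, and the floor with the
FULL bottom `ε(a) ≤ ε_ev(a)`.  Here: the **even-sector form-domain bound** `evenFormDomainPos` — for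
`a > 0` and every EVEN `f ∈ L²` vanishing a.e. off `[-a, a]` with convergent archimedean energy,
`(M_a + ε_ev(a))‖f‖₂² ≤ P(f) + 𝓔_a(f)` (the even twin of `OddSector.odd_formDomainPos` and of
`WeilWindowFlowWindowLipschitz.stub_formDomainPos`) — whence **`galerkinRayleighRitz :
GalerkinRayleighRitz` with no hypothesis** (the cut-off profile is even): `ε_ev(a) ≤ bottomRayleigh
(zetaDatum (a, N))` for every `N`, and a negative Galerkin quotient of `ζ`'s even block at `(a, N)`
forces `ε_ev(a) < 0`.  Inputs (i)/(ii) are bypassed for GAL‑0.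

Proof: truncate to `[-a, a]` (still even); mollify by Mathlib's normalised bumps `Kₙ` of outer radius
`1/(n+1)` — `Kₙ` is even (`ContDiffBump.normed_neg`), so `gₙ = Kₙ ⋆ f` is an EVEN test function
(`convolution_neg_of_neg_eq`) on `bₙ = a + 1/(n+1)` with `D_t(gₙ) ≤ D_t(f)`
(`WeilGroundStateMarkovPart.weilIncrement_mollify_le`); then `ε_ev(bₙ)‖gₙ‖² ≤ Re Q(gₙ) = P(gₙ) +
𝓔_{bₙ}(gₙ) − M_{bₙ}‖gₙ‖²` (`weilEvenGroundEnergy_mul_le_re`), `𝓔_{bₙ}(gₙ) ≤ 𝓔_{bₙ}(f) = 𝓔_a(f) +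
(M_{bₙ} − M_a)‖f‖²` (`OddSector.weilDirichletEnergy_window'`); as `n → ∞`, `gₙ → f` in `L²`,
`P(gₙ) → P(f)` (`OddSector.tendsto_weilPoleForm_of_window`), `M_{bₙ}` stays bounded and
`ε_ev(bₙ) → ε_ev(a)` (`stub_sectorContinuity_continuousAt_even`, Bombieri 2000 §4 Thm 5).

References: E. Bombieri, *Remarks on Weil's quadratic functional in the theory of prime numbers I*,
Rend. Mat. Acc. Lincei (9) 11 (2000) 183–233, §4 Thm 5; M. Fukushima, Y. Oshima, M. Takeda,
*Dirichlet Forms and Symmetric Markov Processes*, de Gruyter (2011), §1.1.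
-/

set_option linter.dupNamespace false

noncomputable section

open MeasureTheory Set Filter ContinuousLinearMap Matrix
open scoped Topology ENNReal NNReal ComplexConjugate Convolution ArithmeticFunction.vonMangoldt

namespace Summit.RiemannHypothesis.RiemannHypothesis.Theorems.PfPersistence

open Literature.NumberTheory.LFunctions Literature.NumberTheory.LFunctions.ConnesVanSuijlekom
open Summit.RiemannHypothesis.RiemannHypothesis.Theorems.WeilGroundStateMarkovPart
  (weilIncrement_mollify_le weilIncrement_congr_ae weilDirichletEnergy_congr_ae)
open Summit.RiemannHypothesis.RiemannHypothesis.Theorems.WeilWindowFlowWindowLipschitz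
  (stub_supBound_weilMarkovConstant_mono)
open Summit.RiemannHypothesis.RiemannHypothesis.Theorems.OddSector
  (weilDirichletEnergy_window' tendsto_weilPoleForm_of_window)

namespace EvenFormDomain

/-- **Even mollified approximants of an even window function.** For an EVEN `f ∈ L²` vanishing off
`[-a, a]` the mollifications `gₙ = Kₙ ⋆ f` by normalised bumps of outer radius `1/(n+1)` are EVEN
test functions supported in `[-(a + 1/(n+1)), a + 1/(n+1)]`, with `D_t(gₙ) ≤ D_t(f)`, converging to
`f` in `L²` (even twin of `OddSector.exists_odd_mollified_seq`). [folklore] -/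
theorem exists_even_mollified_seq {a : ℝ} {f : ℝ → ℂ} (hf : MemLp f 2)
    (hfs : ∀ x, x ∉ Icc (-a) a → f x = 0) (hfe : ∀ x, f (-x) = f x) :
    ∃ g : ℕ → ℝ → ℂ,
      (∀ n, IsWeilTest (g n)) ∧
      (∀ n, tsupport (g n) ⊆ Icc (-(a + 1 / ((n : ℝ) + 1))) (a + 1 / ((n : ℝ) + 1))) ∧
      (∀ n t, g n (-t) = g n t) ∧
      (∀ n t, weilIncrement (g n) t ≤ weilIncrement f t) ∧
      Tendsto (fun n ↦ ∫ x, ‖g n x - f x‖ ^ 2) atTop (𝓝 0) := by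
  -- adapted from `OddSector.exists_odd_mollified_seq`, parity `odd ↦ even`
  set φ : ℕ → ContDiffBump (0 : ℝ) := fun n ↦
    ⟨1 / ((n : ℝ) + 2), 1 / ((n : ℝ) + 1), by positivity,
      one_div_lt_one_div_of_lt (by positivity) (by linarith)⟩
  have hrOut : ∀ n, (φ n).rOut = 1 / ((n : ℝ) + 1) := fun n ↦ rfl
  have hfl : LocallyIntegrable f volume := hf.locallyIntegrable one_le_two
  have hfc : HasCompactSupport f := HasCompactSupport.intro isCompact_Icc hfs
  have hmem : ∀ n, MemLp ((φ n).normed volume ⋆[lsmul ℝ ℝ, volume] f) 2 volume := fun n ↦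
    Literature.Analysis.UnboundedOperators.memLp_convolution_lsmul (φ n).integrable_normed hf
      one_le_two
  refine ⟨fun n ↦ (φ n).normed volume ⋆[lsmul ℝ ℝ, volume] f, fun n ↦ ⟨?_, ?_⟩, fun n ↦ ?_,
    fun n t ↦ ?_, fun n t ↦ weilIncrement_mollify_le (φ n) hf t, ?_⟩
  · exact ((φ n).hasCompactSupport_normed (μ := volume)).contDiff_convolution_left _
      (φ n).contDiff_normed hfl
  · exact ((φ n).hasCompactSupport_normed (μ := volume)).convolution _ hfc
  · refine closure_minimal (fun x hx ↦ ?_) isClosed_Icc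
    obtain ⟨y, hy, z, hz, rfl⟩ := support_convolution_subset (L := lsmul ℝ ℝ) (μ := volume)
      (f := (φ n).normed volume) (g := f) hx
    rw [(φ n).support_normed_eq, hrOut, Metric.mem_ball, dist_zero_right, Real.norm_eq_abs,
      abs_lt] at hy
    have hz' : z ∈ Icc (-a) a := not_not.1 fun h ↦ hz (hfs z h)
    constructor <;> linarith [hz'.1, hz'.2, hy.1, hy.2]
  · exact convolution_neg_of_neg_eq (lsmul ℝ ℝ) (Eventually.of_forall fun y ↦ (φ n).normed_neg y)
      (Eventually.of_forall hfe)
  · have hT := Literature.Analysis.FunctionSpaces.tendsto_eLpNorm_normed_convolution_sub_self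
      (μ := volume) (φ := φ) (l := atTop)
      (tendsto_one_div_add_atTop_nhds_zero_nat (𝕜 := ℝ)) one_le_two ENNReal.ofNat_ne_top hf
    have hT' : Tendsto (fun n ↦ Real.sqrt
        (∫ x, ‖((φ n).normed volume ⋆[lsmul ℝ ℝ, volume] f) x - f x‖ ^ 2)) atTop (𝓝 0) := by
      have h2 := (ENNReal.tendsto_toReal ENNReal.zero_ne_top).comp hT
      rw [ENNReal.toReal_zero] at h2
      refine h2.congr fun n ↦ ?_
      rw [Function.comp_apply, eLpNorm_two_eq_ofReal_sqrt ((hmem n).sub hf),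
        ENNReal.toReal_ofReal (Real.sqrt_nonneg _)]
      rfl
    have h3 := hT'.pow 2
    rw [zero_pow two_ne_zero] at h3
    refine h3.congr fun n ↦ ?_
    exact Real.sq_sqrt (integral_nonneg fun _ ↦ by positivity)

/-- **One even step.** For an EVEN test function `g` on the window `[-b, b]`, `b ≥ a`, whose
increments are dominated by those of a finite-energy `f` living on `[-a, a]`:
`ε_ev(b)‖g‖² + M_a‖f‖² + M_b(‖g‖² − ‖f‖²) ≤ P(g) + 𝓔_a(f)` (even twin of `OddSector.odd_step_le`).
[folklore] -/
theorem even_step_le {a b : ℝ} (hab : a ≤ b) {f g : ℝ → ℂ} (hf : MemLp f 2)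
    (hfs : ∀ x, x ∉ Icc (-a) a → f x = 0)
    (harch : IntegrableOn (fun t ↦ weilArchDensity t * weilIncrement f t) (Ioi 0))
    (hg : IsWeilTest g) (hgs : tsupport g ⊆ Icc (-b) b) (hge : ∀ t, g (-t) = g t)
    (hD : ∀ t, weilIncrement g t ≤ weilIncrement f t) :
    weilEvenGroundEnergy b * (∫ x, ‖g x‖ ^ 2) + weilMarkovConstant a * (∫ x, ‖f x‖ ^ 2) +
        weilMarkovConstant b * ((∫ x, ‖g x‖ ^ 2) - ∫ x, ‖f x‖ ^ 2) ≤
      weilPoleForm g + weilDirichletEnergy a f := by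
  have h1 := weilEvenGroundEnergy_mul_le_re hg hgs hge
  have h2 := weilQuadratic_re_eq_weilPoleForm_add_weilDirichletEnergy_sub hg hgs
  have h3 : weilDirichletEnergy b g ≤ weilDirichletEnergy b f := by
    unfold weilDirichletEnergy
    refine add_le_add (Finset.sum_le_sum fun n _ ↦ mul_le_mul_of_nonneg_left (hD _)
      (div_nonneg ArithmeticFunction.vonMangoldt_nonneg (Real.sqrt_nonneg _))) ?_
    refine integral_mono_of_nonneg ?_ harch ?_
    · exact (ae_restrict_iff' measurableSet_Ioi).2 (Eventually.of_forall fun t ht ↦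
        mul_nonneg (weilArchDensity_pos ht).le (weilIncrement_nonneg _ t))
    · exact (ae_restrict_iff' measurableSet_Ioi).2 (Eventually.of_forall fun t ht ↦
        mul_le_mul_of_nonneg_left (hD t) (weilArchDensity_pos ht).le)
  have h4 := weilDirichletEnergy_window' hab hf hfs
  rw [sub_mul] at h4
  rw [mul_sub]
  linarith

/-- **The even inequality for functions living on the window** (pointwise support hypothesis): the
limit `n → ∞` of `even_step_le` along the even mollified approximants, using the continuity of the
even-sector bottom `ε_ev` at `a` (even twin of `OddSector.odd_formDomainPos`). [folklore] -/
theorem even_core_le {a : ℝ} (ha : 0 < a) {f : ℝ → ℂ} (hf : MemLp f 2)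
    (hfs : ∀ x, x ∉ Icc (-a) a → f x = 0) (hfe : ∀ x, f (-x) = f x)
    (harch : IntegrableOn (fun t ↦ weilArchDensity t * weilIncrement f t) (Ioi 0)) :
    (weilMarkovConstant a + weilEvenGroundEnergy a) * ∫ x, ‖f x‖ ^ 2 ≤
      weilPoleForm f + weilDirichletEnergy a f := by
  obtain ⟨g, hg, hgs, hge, hD, hlim⟩ := exists_even_mollified_seq hf hfs hfe
  have hr0 : ∀ n : ℕ, (0 : ℝ) < 1 / ((n : ℝ) + 1) := fun n ↦ by positivity
  have hr1 : ∀ n : ℕ, 1 / ((n : ℝ) + 1) ≤ 1 := fun n ↦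
    div_le_one_of_le₀ (by linarith [n.cast_nonneg (α := ℝ)]) (by positivity)
  have hgm : ∀ n, MemLp (g n) 2 := fun n ↦ (hg n).memLp_two
  have hN : Tendsto (fun n ↦ ∫ x, ‖g n x‖ ^ 2) atTop (𝓝 (∫ x, ‖f x‖ ^ 2)) :=
    tendsto_integral_norm_sq hf hgm hlim
  have hfR : ∀ x, x ∉ Icc (-(a + 1)) (a + 1) → f x = 0 := fun x hx ↦
    hfs x fun h ↦ hx (Icc_subset_Icc (by linarith) (by linarith) h)
  have hgR : ∀ n x, x ∉ Icc (-(a + 1)) (a + 1) → g n x = 0 := fun n x hx ↦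
    image_eq_zero_of_notMem_tsupport fun h ↦
      hx (Icc_subset_Icc (by linarith [hr1 n]) (by linarith [hr1 n]) (hgs n h))
  have hP : Tendsto (fun n ↦ weilPoleForm (g n)) atTop (𝓝 (weilPoleForm f)) :=
    tendsto_weilPoleForm_of_window hf hgm hfR hgR hlim
  have hb : Tendsto (fun n : ℕ ↦ a + 1 / ((n : ℝ) + 1)) atTop (𝓝 a) := by
    have := (tendsto_const_nhds (x := a) (f := (atTop : Filter ℕ))).add
      (tendsto_one_div_add_atTop_nhds_zero_nat (𝕜 := ℝ))
    rwa [add_zero] at this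
  have hε : Tendsto (fun n : ℕ ↦ weilEvenGroundEnergy (a + 1 / ((n : ℝ) + 1))) atTop
      (𝓝 (weilEvenGroundEnergy a)) :=
    (stub_sectorContinuity_continuousAt_even ha).tendsto.comp hb
  have hMB : ∀ n : ℕ, |weilMarkovConstant (a + 1 / ((n : ℝ) + 1))| ≤
      |weilMarkovConstant a| + |weilMarkovConstant (a + 1)| := fun n ↦ by
    have h1 := stub_supBound_weilMarkovConstant_mono
      (show a ≤ a + 1 / ((n : ℝ) + 1) by linarith [hr0 n])
    have h2 := stub_supBound_weilMarkovConstant_mono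
      (show a + 1 / ((n : ℝ) + 1) ≤ a + 1 by linarith [hr1 n])
    rcases abs_cases (weilMarkovConstant (a + 1 / ((n : ℝ) + 1))) with h | h <;>
    rcases abs_cases (weilMarkovConstant a) with h' | h' <;>
    rcases abs_cases (weilMarkovConstant (a + 1)) with h'' | h'' <;> linarith
  have hM : Tendsto (fun n : ℕ ↦ weilMarkovConstant (a + 1 / ((n : ℝ) + 1)) *
      ((∫ x, ‖g n x‖ ^ 2) - ∫ x, ‖f x‖ ^ 2)) atTop (𝓝 0) := by
    refine squeeze_zero_norm (fun n ↦ ?_)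
      (a := fun n ↦ (|weilMarkovConstant a| + |weilMarkovConstant (a + 1)|) *
        |(∫ x, ‖g n x‖ ^ 2) - ∫ x, ‖f x‖ ^ 2|) ?_
    · rw [norm_mul, Real.norm_eq_abs, Real.norm_eq_abs]
      exact mul_le_mul_of_nonneg_right (hMB n) (abs_nonneg _)
    · have := (tendsto_sub_nhds_zero_iff.2 hN).abs.const_mul
        (|weilMarkovConstant a| + |weilMarkovConstant (a + 1)|)
      simpa using this
  have hL := ((hε.mul hN).add (tendsto_const_nhds
    (x := weilMarkovConstant a * ∫ x, ‖f x‖ ^ 2) (f := (atTop : Filter ℕ)))).add hM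
  have hR := hP.add (tendsto_const_nhds (x := weilDirichletEnergy a f) (f := (atTop : Filter ℕ)))
  have key := le_of_tendsto_of_tendsto' hL hR fun n ↦
    even_step_le (show a ≤ a + 1 / ((n : ℝ) + 1) by linarith [hr0 n]) hf hfs harch (hg n) (hgs n)
      (hge n) (hD n)
  rw [add_mul]
  linarith

end EvenFormDomain

open EvenFormDomain

/-- **THE EVEN-SECTOR FORM-DOMAIN BOUND (PROVED, RH-free).**  Smooth even tests are dense from above
in the even form domain of the window: for every EVEN `f ∈ L²` vanishing a.e. off `[-a, a]` (`a > 0`)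
with finite archimedean energy, `(M_a + ε_ev(a))‖f‖₂² ≤ P(f) + 𝓔_a(f)`, with the EVEN-sector bottom
`ε_ev(a) = weilEvenGroundEnergy a ≥ ε(a)` in place of the full bottom of `stub_formDomainPos`.
Proof: truncate to the window (evenness is kept), then `EvenFormDomain.even_core_le`.
[cite: Bombieri2000Weil, §4 Thm. 5 (p. 197)] -/
theorem evenFormDomainPos :
    ∀ a : ℝ, 0 < a → ∀ f : ℝ → ℂ, MemLp f 2 → (∀ᵐ x : ℝ, x ∉ Icc (-a) a → f x = 0) →
      (∀ x, f (-x) = f x) →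
      IntegrableOn (fun t ↦ weilArchDensity t * weilIncrement f t) (Ioi 0) →
        (weilMarkovConstant a + weilEvenGroundEnergy a) * ∫ x, ‖f x‖ ^ 2 ≤
          weilPoleForm f + weilDirichletEnergy a f := by
  intro a ha f hf hz hfe harch
  set f' : ℝ → ℂ := (Icc (-a) a).indicator f with hf'
  have hsymm : ∀ x : ℝ, -x ∈ Icc (-a) a ↔ x ∈ Icc (-a) a := fun x ↦ by
    simp only [mem_Icc]; constructor <;> intro h <;> constructor <;> linarith [h.1, h.2]
  have hff' : f =ᵐ[volume] f' := by
    filter_upwards [hz] with x hx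
    by_cases hm : x ∈ Icc (-a) a
    · rw [hf', indicator_of_mem hm]
    · rw [hf', indicator_of_notMem hm, hx hm]
  have hf'm : MemLp f' 2 := MemLp.ae_eq hff' hf
  have hf's : ∀ x, x ∉ Icc (-a) a → f' x = 0 := fun x hx ↦ indicator_of_notMem hx _
  have hf'e : ∀ x, f' (-x) = f' x := fun x ↦ by
    by_cases hm : x ∈ Icc (-a) a
    · rw [hf', indicator_of_mem ((hsymm x).2 hm), indicator_of_mem hm, hfe]
    · rw [hf', indicator_of_notMem (mt (hsymm x).1 hm), indicator_of_notMem hm]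
  have hN : ∫ x, ‖f x‖ ^ 2 = ∫ x, ‖f' x‖ ^ 2 :=
    integral_congr_ae (hff'.mono fun x hx ↦ by simp only [hx])
  have hmul : ∀ w : ℝ → ℂ, ∫ t, f t * w t = ∫ t, f' t * w t := fun w ↦
    integral_congr_ae (hff'.mono fun x hx ↦ by simp only [hx])
  have hP : weilPoleForm f = weilPoleForm f' := by
    unfold weilPoleForm
    rw [hmul (fun t ↦ (Real.cosh (t / 2) : ℂ)), hmul (fun t ↦ (Real.sinh (t / 2) : ℂ))]
  have hD : weilIncrement f = weilIncrement f' := weilIncrement_congr_ae hff'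
  have hE : weilDirichletEnergy a f = weilDirichletEnergy a f' := weilDirichletEnergy_congr_ae a hff'
  rw [hN, hP, hE]
  rw [hD] at harch
  exact even_core_le ha hf'm hf's hf'e harch

/-! ## GAL‑0 as typed, unconditionally -/

section Galerkin

variable (win : Window) (v : Fin (win.N + 1) → ℝ)

/-- **GAL‑0 WITH THE EVEN GROUND ENERGY (PROVED, RH-free, unconditional):**
`ε_ev(a) · (v ⬝ᵥ v) ≤ v ⬝ᵥ (zetaDatum (a,N) · v)` — the continuum even-sector Weil ground energy at
half-length `a` is a floor for every Galerkin Rayleigh quotient of `ζ`'s even block at `(a, N)`: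
`galerkinForm_eq_closedForm` + `evenFormDomainPos` at the (even — `cutoffProfile_neg` —, `L²`,
windowed, finite-energy) cut-off profile. [folklore] -/
theorem weilEvenGroundEnergy_mul_le_galerkinForm :
    weilEvenGroundEnergy win.a * (v ⬝ᵥ v) ≤ v ⬝ᵥ (zetaDatum win *ᵥ v) := by
  have h := evenFormDomainPos win.a win.ha (cutoffProfile win v) (memLp_cutoffProfile win v)
    (ae_of_all _ fun x hx => cutoffProfile_eq_zero_of_not_mem win v hx) (cutoffProfile_neg win v)
    (integrableOn_archEnergy_cutoffProfile win v)
  rw [galerkinForm_eq_closedForm, integral_norm_sq_cutoffProfile]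
  rw [integral_norm_sq_cutoffProfile] at h
  linarith

/-- **GAL‑0 AS TYPED, DISCHARGED BY NAME (PROVED, RH-free, no hypothesis):**
`GalerkinRayleighRitz` of `PfPersistenceGalerkinFormDomain` holds — `ε_ev(a) ≤ ε₁^{(N)}(a)` at every
window, the Rayleigh–Ritz direction of the Galerkin ↔ continuum dictionary; neither
`GalerkinMatrixIdentity` (i) nor `CutoffProfileFormDensity` (ii) is used. [folklore] -/
theorem galerkinRayleighRitz : GalerkinRayleighRitz :=
  fun win v => weilEvenGroundEnergy_mul_le_galerkinForm win v

/-- **PROVED (RH-free, unconditional): `ε_ev(a) ≤ bottomRayleigh (ζ even block at (a, N))`** for every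
window — the served bottom eigenvalue `eps1_even(a, N)` is an UPPER bound for the continuum even
ground energy at the same half-length. [folklore] -/
theorem weilEvenGroundEnergy_le_bottomRayleigh' (win : Window) :
    weilEvenGroundEnergy win.a ≤ bottomRayleigh (zetaDatum win) :=
  weilEvenGroundEnergy_le_bottomRayleigh galerkinRayleighRitz win

/-- **PROVED (RH-free, unconditional):** a negative Galerkin Rayleigh quotient of `ζ`'s even block at
`(a, N)` forces `ε_ev(a) < 0` — Galerkin-level negative findings read AT `ζ` are continuum
EVEN-sector findings. [folklore] -/
theorem weilEvenGroundEnergy_neg_of_form_neg' (hneg : v ⬝ᵥ (zetaDatum win *ᵥ v) < 0) :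
    weilEvenGroundEnergy win.a < 0 :=
  weilEvenGroundEnergy_neg_of_form_neg galerkinRayleighRitz win v hneg

/-- **PROVED (RH-free, unconditional):** a negative served bottom quotient `eps1_even(a, N) < 0` at ANY
truncation `N` certifies `ε_ev(a) < 0` (every rung of the `N`-ladder sits above the same continuum
number). [folklore] -/
theorem weilEvenGroundEnergy_neg_of_bottomRayleigh_neg (win : Window)
    (h : bottomRayleigh (zetaDatum win) < 0) : weilEvenGroundEnergy win.a < 0 :=
  lt_of_le_of_lt (weilEvenGroundEnergy_le_bottomRayleigh' win) h

/-- **PROVED (RH-free, unconditional): a continuum EVEN floor is a Galerkin floor at every truncation** —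
`-σ ≤ ε_ev(a) ⇒ GalerkinFloorAt a σ` (sharpens `galerkinFloorAt_of_neg_le_weilGroundEnergy`, which needs
the floor on the full bottom `ε(a) ≤ ε_ev(a)`).  The converse, Galerkin floors at all `N` ⇒ `-σ ≤ ε_ev(a)`,
is GAL‑1 and needs the density input (ii″) `TestToGalerkinFormDensity`. [folklore] -/
theorem galerkinFloorAt_of_neg_le_weilEvenGroundEnergy {a σ : ℝ} (ha : 0 < a)
    (h : -σ ≤ weilEvenGroundEnergy a) : GalerkinFloorAt a ha σ := fun N v =>
  (mul_le_mul_of_nonneg_right h (Finset.sum_nonneg fun i _ => mul_self_nonneg (v i))).trans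
    (weilEvenGroundEnergy_mul_le_galerkinForm ⟨a, N, ha⟩ v)

end Galerkin

end Summit.RiemannHypothesis.RiemannHypothesis.Theorems.PfPersistence

end
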